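import Summits.Ventures.LatticeQCDFlow.Exactness.Phi4LocalMetropolisExact
import Mathlib.MeasureTheory.Integral.Prod
import HarnessLib

/-!
# The mean squared ENERGY change of a Metropolis step is at most `8/e²` (Caracciolo–Pelissetto–Sokal), on the line

HONEST FRAMING: exact (Metropolis-corrected) sampling algorithms for lattice gauge theory;
figures of merit are autocorrelation/cost numbers at stated couplings and volumes; no
continuum-physics claim.  (SCALAR calibration rung S0-A: not a gauge result.)

Venture `LatticeQCDFlow` (cell pub-lqcd), topic `Exactness`; FANOUT row 2 (`s0-phi4`, LOCAL arm).
NEW WORK of the cell over Mathlib (Fubini on `ℝ²`) and row 2's `integrable_weight_mul_proposal`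
(`Phi4LocalMetropolisExact`).  Nothing is cited as a fact.  Printed counterpart, NAMED ONLY:
Caracciolo–Pelissetto–Sokal, *A general limitation on Monte Carlo algorithms of Metropolis type*,
Phys. Rev. Lett. 72 (1994) 179 (arXiv:hep-lat/9307021), Proposition: for a Metropolis chain with
energy `H`, `⟨(ΔH)²⟩ ≤ (8/e²) f₊ ≤ 8/e²` per step (finite state space; `z² e^{−z} ≤ 4/e²` plus
detailed balance).  HERE: the random-walk Metropolis kernel on the LINE with weight `e^{−S(t)} dt`
and an even step density, the one-dimensional building block of row 2's single-site hit; the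
detailed-balance symmetry is replaced by the pointwise bound
`min(w, w') (ΔS)² ≤ (4/e²)(w + w')` and ONE Fubini swap (`∫∫ w(t') ρ(t' − t) = ∫ w`).

## What is proved

* `accept_mul_sq_le` — `min(1, e^{−Δ}) Δ² ≤ 4 e^{−2} (1 + e^{−Δ})` for every real `Δ`;
* `integrable_weight_shift`, `integral_integral_weight_shift` — `(t, t') ↦ w(t') ρ(t' − t)` is
  integrable on `ℝ²` with `∫∫ = ∫ w` (`ρ` an even probability density);
* **`line_energy_carre_le`** — for `w = e^{−S}` integrable, `ρ` an even probability density and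
  `f` with `|f(t') − f(t)| ≤ |S(t') − S(t)|` (any 1-Lipschitz function of the
  energy):  `∫ (∫ min(1, w(t')/w(t)) (f(t') − f(t))² ρ(t' − t) dt') w(t) dt ≤ 8 e^{−2} ∫ w`.

The lattice assembly (per coordinate line, then the random-site scan) and the resulting
CRITICAL-SLOWING-DOWN floor for the action are `Exactness/Phi4MetropolisActionCSD.lean`.
-/

namespace Summit.Ventures.LatticeQCDFlow.Exactness

open Real MeasureTheory Filter Finset
open Summit.Ventures.LatticeQCDFlow.Scoring

section LineEnergy

/-- **The Metropolis-accepted squared energy change is uniformly bounded**: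
`min(1, e^{−Δ}) Δ² ≤ 4 e^{−2} (1 + e^{−Δ})` for every real `Δ` (uphill: `e^{−Δ}Δ² ≤ 4/e²`;
downhill: `Δ² ≤ (4/e²) e^{|Δ|}`). -/
theorem accept_mul_sq_le (Δ : ℝ) :
    min 1 (Real.exp (-Δ)) * Δ ^ 2 ≤ 4 * Real.exp (-2) * (1 + Real.exp (-Δ)) := by
  -- `z² e^{−z} ≤ 4/e²` for `z ≥ 0` (maximum at `z = 2`; from `1 + u ≤ eᵘ` at `u = z/2 − 1`;
  -- the same one-liner serves `WeilCombBohrFejer.sq_mul_exp_neg_le_bumpLip` in the RH tree)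
  have sq_mul_exp_neg_le : ∀ {z : ℝ}, 0 ≤ z → z ^ 2 * Real.exp (-z) ≤ 4 * Real.exp (-2) := by
    intro z hz
    have h1 : z / 2 ≤ Real.exp (z / 2 - 1) := by linarith [Real.add_one_le_exp (z / 2 - 1)]
    have hz2 : 0 ≤ z / 2 := by linarith
    calc z ^ 2 * Real.exp (-z) = (z / 2) ^ 2 * 4 * Real.exp (-z) := by ring
      _ ≤ Real.exp (z / 2 - 1) ^ 2 * 4 * Real.exp (-z) := by gcongr
      _ = 4 * Real.exp ((z / 2 - 1) + (z / 2 - 1) + -z) := by rw [Real.exp_add, Real.exp_add]; ring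
      _ = 4 * Real.exp (-2) := by congr 1; ring
  have h4 : 0 ≤ 4 * Real.exp (-2) := by positivity
  rcases le_or_gt 0 Δ with hΔ | hΔ
  · calc min 1 (Real.exp (-Δ)) * Δ ^ 2 ≤ Real.exp (-Δ) * Δ ^ 2 :=
          mul_le_mul_of_nonneg_right (min_le_right _ _) (sq_nonneg _)
      _ = Δ ^ 2 * Real.exp (-Δ) := mul_comm _ _
      _ ≤ 4 * Real.exp (-2) := sq_mul_exp_neg_le hΔ
      _ ≤ 4 * Real.exp (-2) * (1 + Real.exp (-Δ)) := by
          have : (1 : ℝ) ≤ 1 + Real.exp (-Δ) := by linarith [Real.exp_pos (-Δ)]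
          nlinarith
  · have h := sq_mul_exp_neg_le (z := -Δ) (by linarith)
    rw [neg_neg] at h
    have hmin : min 1 (Real.exp (-Δ)) ≤ 1 := min_le_left _ _
    have hmin0 : 0 ≤ min 1 (Real.exp (-Δ)) := le_min zero_le_one (Real.exp_pos _).le
    have e1 : (-Δ) ^ 2 = Δ ^ 2 := by ring
    rw [e1] at h
    -- `Δ² = (Δ² e^{Δ}) e^{−Δ} ≤ 4e^{−2} e^{−Δ}`
    have h5 : Δ ^ 2 ≤ 4 * Real.exp (-2) * Real.exp (-Δ) := by
      have := mul_le_mul_of_nonneg_right h (Real.exp_pos (-Δ)).le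
      calc Δ ^ 2 = Δ ^ 2 * (Real.exp Δ * Real.exp (-Δ)) := by
            rw [← Real.exp_add, add_neg_cancel, Real.exp_zero, mul_one]
        _ = Δ ^ 2 * Real.exp Δ * Real.exp (-Δ) := by ring
        _ ≤ 4 * Real.exp (-2) * Real.exp (-Δ) := this
    calc min 1 (Real.exp (-Δ)) * Δ ^ 2 ≤ 1 * Δ ^ 2 := mul_le_mul_of_nonneg_right hmin (sq_nonneg _)
      _ ≤ 4 * Real.exp (-2) * Real.exp (-Δ) := by rw [one_mul]; exact h5
      _ ≤ 4 * Real.exp (-2) * (1 + Real.exp (-Δ)) := by nlinarith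

/-- The sheared weight `(t, t') ↦ w(t') ρ(t' − t)` is integrable on `ℝ²` (`ρ` even). -/
theorem integrable_weight_shift {w ρ : ℝ → ℝ} (hwm : Measurable w) (hwi : Integrable w)
    (hw0 : ∀ t, 0 ≤ w t) (hρm : Measurable ρ) (hρi : Integrable ρ) (hρ0 : ∀ u, 0 ≤ ρ u)
    (hρ1 : ∫ u, ρ u = 1) (hρs : ∀ u, ρ (-u) = ρ u) :
    Integrable (fun p : ℝ × ℝ => w p.2 * ρ (p.2 - p.1)) ((volume : Measure ℝ).prod volume) := by
  have hG := (integrable_weight_mul_proposal hwm hwi hw0 hρm hρi hρ0 hρ1).swap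
  refine hG.congr (Eventually.of_forall fun p => ?_)
  simp only [Function.comp_apply, Prod.fst_swap, Prod.snd_swap]
  rw [show p.1 - p.2 = -(p.2 - p.1) by ring, hρs]

/-- **One Fubini swap**: `∫ (∫ w(t') ρ(t' − t) dt') dt = ∫ w` (`ρ` an even probability density). -/
theorem integral_integral_weight_shift {w ρ : ℝ → ℝ} (hwm : Measurable w) (hwi : Integrable w)
    (hw0 : ∀ t, 0 ≤ w t) (hρm : Measurable ρ) (hρi : Integrable ρ) (hρ0 : ∀ u, 0 ≤ ρ u)
    (hρ1 : ∫ u, ρ u = 1) (hρs : ∀ u, ρ (-u) = ρ u) :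
    ∫ t, ∫ t', w t' * ρ (t' - t) = ∫ t, w t := by
  have hG := integrable_weight_mul_proposal hwm hwi hw0 hρm hρi hρ0 hρ1
  have hQ := integrable_weight_shift hwm hwi hw0 hρm hρi hρ0 hρ1 hρs
  have e1 : ∫ t, ∫ t', w t' * ρ (t' - t) = ∫ p, w p.2 * ρ (p.2 - p.1) ∂((volume : Measure ℝ).prod volume) :=
    (integral_prod _ hQ).symm
  have e2 : ∫ p, w p.2 * ρ (p.2 - p.1) ∂((volume : Measure ℝ).prod volume)
      = ∫ p, w p.1 * ρ (p.2 - p.1) ∂((volume : Measure ℝ).prod volume) := by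
    rw [← integral_prod_swap]
    refine integral_congr_ae (Eventually.of_forall fun p => ?_)
    simp only [Prod.fst_swap, Prod.snd_swap]
    rw [show p.1 - p.2 = -(p.2 - p.1) by ring, hρs]
  have e3 : ∫ p, w p.1 * ρ (p.2 - p.1) ∂((volume : Measure ℝ).prod volume)
      = ∫ t, ∫ t', w t * ρ (t' - t) := integral_prod _ hG
  rw [e1, e2, e3]
  refine integral_congr_ae (Eventually.of_forall fun t => ?_)
  dsimp only
  rw [integral_const_mul, integral_sub_right_eq_self (μ := (volume : Measure ℝ)) ρ t, hρ1, mul_one]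

/-- **THE LINE-LEVEL ENERGY BOUND (Caracciolo–Pelissetto–Sokal on the line).**  `w = e^{−S}`
integrable, `ρ` an even probability density, `f` with `|f(t') − f(t)| ≤ |S(t') − S(t)|` (when the
inner integrand is not integrable the inner integral is `0` by convention and the bound is trivial).  Then the `w`-averaged mean squared one-step change of `f` under
random-walk Metropolis is at most `8/e²` per unit of `∫ w`:
`∫ (∫ min(1, w(t')/w(t)) (f(t') − f(t))² ρ(t' − t) dt') w(t) dt ≤ 8 e^{−2} ∫ w`. -/
theorem line_energy_carre_le {S ρ f : ℝ → ℝ} (hSm : Measurable S)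
    (hwi : Integrable (fun t => Real.exp (-S t))) (hρ0 : ∀ u, 0 ≤ ρ u) (hρm : Measurable ρ)
    (hρi : Integrable ρ) (hρ1 : ∫ u, ρ u = 1) (hρs : ∀ u, ρ (-u) = ρ u)
    (hfS : ∀ t t', |f t' - f t| ≤ |S t' - S t|) :
    ∫ t, (∫ t', min 1 (Real.exp (-S t') / Real.exp (-S t)) * (f t' - f t) ^ 2 * ρ (t' - t))
        * Real.exp (-S t)
      ≤ 8 * Real.exp (-2) * ∫ t, Real.exp (-S t) := by
  set w : ℝ → ℝ := fun t => Real.exp (-S t) with hw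
  have hw0 : ∀ t, 0 < w t := fun t => Real.exp_pos _
  have hwm : Measurable w := Real.measurable_exp.comp hSm.neg
  have hQ := integrable_weight_shift hwm hwi (fun t => (hw0 t).le) hρm hρi hρ0 hρ1 hρs
  have hW : Integrable (fun t => ∫ t', w t' * ρ (t' - t)) := hQ.integral_prod_left
  have hsec := hQ.prod_right_ae
  -- pointwise key bound: `min(w, w') (f' − f)² ρ ≤ 4e^{−2} (w + w') ρ`
  have hkey : ∀ t t', min 1 (w t' / w t) * (f t' - f t) ^ 2 * ρ (t' - t) * w t
      ≤ 4 * Real.exp (-2) * (w t * ρ (t' - t) + w t' * ρ (t' - t)) := by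
    intro t t'
    have hΔ : w t' / w t = Real.exp (-(S t' - S t)) := by
      simp only [hw]
      rw [← Real.exp_sub]
      congr 1
      ring
    have h1 : (f t' - f t) ^ 2 ≤ (S t' - S t) ^ 2 := by
      rw [← sq_abs, ← sq_abs (S t' - S t)]
      exact pow_le_pow_left₀ (abs_nonneg _) (hfS t t') 2
    have hmin0 : 0 ≤ min 1 (w t' / w t) := le_min zero_le_one (div_nonneg (hw0 t').le (hw0 t).le)
    have h2 := accept_mul_sq_le (S t' - S t)
    rw [← hΔ] at h2
    have h3 : Real.exp (-(S t' - S t)) * w t = w t' := by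
      simp only [hw]
      rw [← Real.exp_add]
      congr 1
      ring
    calc min 1 (w t' / w t) * (f t' - f t) ^ 2 * ρ (t' - t) * w t
        ≤ min 1 (w t' / w t) * (S t' - S t) ^ 2 * ρ (t' - t) * w t := by
          have := mul_le_mul_of_nonneg_left h1 hmin0
          exact mul_le_mul_of_nonneg_right (mul_le_mul_of_nonneg_right this (hρ0 _)) (hw0 t).le
      _ ≤ 4 * Real.exp (-2) * (1 + w t' / w t) * ρ (t' - t) * w t :=
          mul_le_mul_of_nonneg_right (mul_le_mul_of_nonneg_right h2 (hρ0 _)) (hw0 t).le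
      _ = 4 * Real.exp (-2) * (w t * ρ (t' - t) + w t' * ρ (t' - t)) := by
          rw [hΔ]
          have := h3
          field_simp
          nlinarith [h3, hρ0 (t' - t), hw0 t, hw0 t']
  -- a.e. in `t`: the inner integral times `w t` is at most `4e^{−2}(w t + ∫ w ρ(· − t))`
  have hρt : ∀ t, Integrable (fun t' => ρ (t' - t)) := fun t => hρi.comp_sub_right t
  have hae : ∀ᵐ t, (∫ t', min 1 (w t' / w t) * (f t' - f t) ^ 2 * ρ (t' - t)) * w t
      ≤ 4 * Real.exp (-2) * (w t + ∫ t', w t' * ρ (t' - t)) := by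
    filter_upwards [hsec] with t ht
    rw [← integral_mul_const]
    have hup : Integrable (fun t' => 4 * Real.exp (-2) * (w t * ρ (t' - t) + w t' * ρ (t' - t))) :=
      (((hρt t).const_mul (w t)).add ht).const_mul _
    calc ∫ t', min 1 (w t' / w t) * (f t' - f t) ^ 2 * ρ (t' - t) * w t
        ≤ ∫ t', 4 * Real.exp (-2) * (w t * ρ (t' - t) + w t' * ρ (t' - t)) := by
          refine integral_mono_of_nonneg (Eventually.of_forall fun t' => ?_) hup
            (Eventually.of_forall fun t' => hkey t t')
          have hmin0 : 0 ≤ min 1 (w t' / w t) :=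
            le_min zero_le_one (div_nonneg (hw0 t').le (hw0 t).le)
          exact mul_nonneg (mul_nonneg (mul_nonneg hmin0 (sq_nonneg _)) (hρ0 _)) (hw0 t).le
      _ = 4 * Real.exp (-2) * (w t + ∫ t', w t' * ρ (t' - t)) := by
          rw [integral_const_mul, integral_add ((hρt t).const_mul (w t)) ht, integral_const_mul,
            integral_sub_right_eq_self (μ := (volume : Measure ℝ)) ρ t, hρ1, mul_one]
  -- integrate over `t`
  have hup2 : Integrable (fun t => 4 * Real.exp (-2) * (w t + ∫ t', w t' * ρ (t' - t))) :=
    (hwi.add hW).const_mul _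
  calc ∫ t, (∫ t', min 1 (w t' / w t) * (f t' - f t) ^ 2 * ρ (t' - t)) * w t
      ≤ ∫ t, 4 * Real.exp (-2) * (w t + ∫ t', w t' * ρ (t' - t)) := by
        refine integral_mono_of_nonneg (Eventually.of_forall fun t => ?_) hup2 hae
        refine mul_nonneg (integral_nonneg fun t' => ?_) (hw0 t).le
        have hmin0 : 0 ≤ min 1 (w t' / w t) := le_min zero_le_one (div_nonneg (hw0 t').le (hw0 t).le)
        exact mul_nonneg (mul_nonneg hmin0 (sq_nonneg _)) (hρ0 _)
    _ = 4 * Real.exp (-2) * ((∫ t, w t) + ∫ t, ∫ t', w t' * ρ (t' - t)) := by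
        rw [integral_const_mul, integral_add hwi hW]
    _ = 8 * Real.exp (-2) * ∫ t, w t := by
        rw [integral_integral_weight_shift hwm hwi (fun t => (hw0 t).le) hρm hρi hρ0 hρ1 hρs]
        ring

end LineEnergy

end Summit.Ventures.LatticeQCDFlow.Exactness
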